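import Summits.Ventures.QEC.Thresholds.ToricCodeXSectorPhenomenologicalMWPM
import Literature.InformationTheory.QuantumCodes.CSSPhenomenologicalBothSectors
import HarnessLib

/-!
# The toric code under Dennis–Kitaev–Landahl–Preskill's own noise model (independent `X` AND `Z` qubit faults at rate `p`, star AND
# plaquette records wrong at rate `q`), both sectors decoded in space-time: certified box `p, q < p₀(4.7476)` — **`p, q ≤ .0112`** —
# for minimum-weight and for MWPM decoder pairs; `P_fail = P^Z + P^X − P^Z·P^X`; diagonal interval `.0112 < p_c ≤ 1/4` — UNCONDITIONAL, kernel

Venture QEC, `Summits/Ventures/QEC/Thresholds/` (LADDER-QEC rung Q5 «toric/surface + MWPM — the DKLP counting bound made explicit and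
kernel-checked», PARTITION row 09; qec-type-09 gen 5). DKLP §5.3: "the accuracy threshold is surely attained provided that … `p, q < .0114`"
(numerical `μ₃`, a CLAIM). This file states the certified version for the COMPLETE memory experiment of §4.1–4.2 (both error types, both
records, ONE probability space `CSSCode.bothSectorsPhenomFailureProb`, `CSSPhenomenologicalBothSectors.lean`) on the lattice toric codes
`toricCode (L+1)`: the `Z`-sector box `phenom_isThresholdBoxLowerBound_kernelZ3SymmK12` (space-time polygon route on qec-type-03's kernel
certificate `μ(ℤ³) ≤ 4.7476`) and the `X`-sector box `toric_x_phenom_isThresholdBoxLowerBound_kernelZ3SymmK12` (space-time duality) combine by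
independence:

| theorem | statement |
|---|---|
| `toric_dklp_failureProb_eq` | `P_fail(p,q) = P^Z(p,q) + P^X(p,q) − P^Z(p,q)·P^X(p,q)` (independence of the two error types) |
| `toric_dklp_isThresholdBoxLowerBound_kernelZ3SymmK12`, `toric_dklp_isThresholdBoxLowerBound_0112` | every poly `T`, every pair of minimum-weight space-time decoders: box `p₀(4.7476)`, **`p, q < .0112` ⇒ `P_fail → 0`** |
| `toric_dklp_mwpm_isThresholdBoxLowerBound_0112` | the same for every pair of space-time MWPM decoders (star record `stLinkEnds`, plaquette record `stEnds plaqEnds`) |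
| `toric_dklp_accuracyThreshold_diag_mem` | diagonal `q = p`: **`.0112 < p_c ≤ 1/4`** (floor: min-weight pairs; ceiling: every pair of space-time decoders, genie bound) |
| `exists_toric_dklp_mwpm_pair` | non-vacuity: an MWPM pair exists (`T(L) = L+1`) with the certified box `.0112` |

All UNCONDITIONAL, tier CERTIFIED (kernel), axioms standard, 0 named facts; the printed `.0114` remains a CLAIM. Theorem-only file.

## References

* [DennisEtAl2002] E. Dennis, A. Kitaev, A. Landahl, J. Preskill, J. Math. Phys. 43 (2002) 4452, arXiv:quant-ph/0110143, §4.1 (chunk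
  p0012 L5–18: the error model), §4.2 (both check types measured each round), §5.1 p. 19 (matching), §5.3 eq. (threshold_iso_num)
  ("p, q < .0114"), §4.6 (p_c).
* [PonitzTittmann2000] A. Pönitz, P. Tittmann, Electron. J. Combin. 7 (2000) R21, Table 2 (`d = 3, k = 12`: `4.7476`).
* [KorteVygen2002] B. Korte, J. Vygen, *Combinatorial Optimization* (2002), §12.2 Thm 12.9.
* [RichardsonUrbanke2008] T. Richardson, R. Urbanke, *Modern Coding Theory*, Lemma 4.78 (the ceiling).
-/

noncomputable section

namespace Summit.Ventures.QEC.Thresholds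

open Filter Topology Finset Matrix
open Literature.InformationTheory.QuantumCodes
open Literature.InformationTheory.QuantumCodes.ToricCode
open Literature.Probability.RandomPlanarGeometry

/-- **`P_fail = P^Z + P^X − P^Z·P^X`** for the toric memory experiment with both error types (the two one-sector two-rate failure
probabilities of the star-record decoder `DZ` and the plaquette-record decoder `DX`). [cite: DennisEtAl2002, §4.1 (chunk p0012 L11–16: X and Z errors uncorrelated; separate recovery)] -/
theorem toric_dklp_failureProb_eq (L T : ℕ) [NeZero L] (DZ : STDecoder L T)
    (DX : CSSPhenom.STDecoder (Vertex L) (Edge L) T) (p q : ℝ) :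
    (toricCode L).bothSectorsPhenomFailureProb T DZ DX p q =
      phenomFailureProb L T DZ p q +
          CSSPhenom.phenomFailureProb (toricCode L).HZ T ((toricCode L).rowSpX : Set (Chain L)) DX p q -
        phenomFailureProb L T DZ p q *
          CSSPhenom.phenomFailureProb (toricCode L).HZ T ((toricCode L).rowSpX : Set (Chain L)) DX p q :=
  (toricCode L).bothSectorsPhenomFailureProb_eq T DZ DX p q

/-- **The DKLP box at the kernel certificate**: for every polynomially bounded schedule and every pair of minimum-weight space-time
decoders (star record, plaquette record), every `0 ≤ p, q < p₀(4.7476)` is below threshold for the complete memory experiment (both error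
types). UNCONDITIONAL, kernel. [cite: DennisEtAl2002, §5.3 eq. (threshold_iso_num)] -/
theorem toric_dklp_isThresholdBoxLowerBound_kernelZ3SymmK12 {T : ℕ → ℕ} (hT : IsPolyBounded T)
    (DZ : (L : ℕ) → STDecoder (L + 1) (T L))
    (hDZ : ∀ L, (DZ L).IsMinWeight (stSyn (L + 1) (T L)) (stCycles (L + 1) (T L)) hammingNorm)
    (DX : ∀ L, CSSPhenom.STDecoder (Vertex (L + 1)) (Edge (L + 1)) (T L))
    (hDX : ∀ L, (DX L).IsMinWeight (CSSPhenom.stSyn (toricCode (L + 1)).HZ (T L))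
      (CSSPhenom.stCycles (toricCode (L + 1)).HZ (T L)) hammingNorm) :
    IsThresholdBoxLowerBound (fun L p q => (toricCode (L + 1)).bothSectorsPhenomFailureProb (T L) (DZ L) (DX L) p q)
      (thresholdValue 4.7476) :=
  CSSCode.bothSectors_isThresholdBoxLowerBound (fun L => toricCode (L + 1)) T DZ DX
    ((thresholdValue_le_half _).trans (by norm_num))
    (phenom_isThresholdBoxLowerBound_kernelZ3SymmK12 hT hDZ)
    (toric_x_phenom_isThresholdBoxLowerBound_kernelZ3SymmK12 hT DX hDX)

/-- **`p, q < .0112` ⇒ `P_fail → 0`** for the complete toric memory experiment (DKLP's model: independent `X`/`Z` faults at rate `p`, both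
records at rate `q`), every poly `T`, every pair of minimum-weight space-time decoders — the certified form of DKLP's "p, q < .0114".
UNCONDITIONAL, kernel. [cite: DennisEtAl2002, §5.3 eq. (threshold_iso_num)] -/
theorem toric_dklp_isThresholdBoxLowerBound_0112 {T : ℕ → ℕ} (hT : IsPolyBounded T)
    (DZ : (L : ℕ) → STDecoder (L + 1) (T L))
    (hDZ : ∀ L, (DZ L).IsMinWeight (stSyn (L + 1) (T L)) (stCycles (L + 1) (T L)) hammingNorm)
    (DX : ∀ L, CSSPhenom.STDecoder (Vertex (L + 1)) (Edge (L + 1)) (T L))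
    (hDX : ∀ L, (DX L).IsMinWeight (CSSPhenom.stSyn (toricCode (L + 1)).HZ (T L))
      (CSSPhenom.stCycles (toricCode (L + 1)).HZ (T L)) hammingNorm) :
    IsThresholdBoxLowerBound (fun L p q => (toricCode (L + 1)).bothSectorsPhenomFailureProb (T L) (DZ L) (DX L) p q) 0.0112 :=
  (toric_dklp_isThresholdBoxLowerBound_kernelZ3SymmK12 hT DZ hDZ DX hDX).mono thresholdValue_47476_bounds.1.le

/-- **The same for every pair of space-time MWPM decoders** (star record matched on `stLinkEnds`, plaquette record on `stEnds plaqEnds`;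
any link metrics, tie-breaks, geodesics): `p, q < .0112` ⇒ `P_fail → 0`. UNCONDITIONAL, kernel.
[cite: DennisEtAl2002, §5.1 p. 19 and §5.3 eq. (threshold_iso_num)] [cite: KorteVygen2002, §12.2 Thm 12.9] -/
theorem toric_dklp_mwpm_isThresholdBoxLowerBound_0112 {T : ℕ → ℕ} (hT : IsPolyBounded T)
    (mZ : ∀ L, EdgeMetric (stLinkEnds (L + 1) (T L))) {DZ : (L : ℕ) → STDecoder (L + 1) (T L)}
    (hDZ : ∀ L, IsMatchingDecoder (mZ L) (DZ L))
    (mX : ∀ L, EdgeMetric (CSSPhenom.stEnds (plaqEnds (L + 1)) (T L)))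
    {DX : ∀ L, CSSPhenom.STDecoder (Vertex (L + 1)) (Edge (L + 1)) (T L)}
    (hDX : ∀ L, IsMatchingDecoder (mX L) (DX L)) :
    IsThresholdBoxLowerBound (fun L p q => (toricCode (L + 1)).bothSectorsPhenomFailureProb (T L) (DZ L) (DX L) p q) 0.0112 :=
  toric_dklp_isThresholdBoxLowerBound_0112 hT DZ (fun L => isMinWeight_of_isMatchingDecoder_st (hDZ L)) DX
    fun L => toric_isMinWeight_of_isMatchingDecoder_plaqST (L + 1) (T L) (hDX L)

/-- **Ceiling**: at `p = 1/4` the complete memory experiment fails with probability `≥ 1/4` for EVERY pair of space-time decoders, every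
`T ≥ 1` and every measurement rate `q ∈ [0, 1]` (the `Z`-sector genie bound). [cite: RichardsonUrbanke2008, Lemma 4.78] [cite: DennisEtAl2002, §4.6] -/
theorem toric_dklp_quarter_le_failureProb (L T : ℕ) [NeZero L] (DZ : STDecoder L T)
    (DX : CSSPhenom.STDecoder (Vertex L) (Edge L) T) (t₀ : Fin T) {q : ℝ} (hq0 : 0 ≤ q) (hq1 : q ≤ 1) :
    1 / 4 ≤ (toricCode L).bothSectorsPhenomFailureProb T DZ DX (1 / 4) q := by
  have h1 := (toricCode L).quarter_le_zPhenom_quarter_aniso_of_symm toricCode_k_pos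
    (fun y => ToricCode.uncorrectableProb_dual y) DZ t₀ hq0 hq1
  have h2 := (toricCode L).max_le_bothSectorsPhenomFailureProb T DZ DX (p := 1 / 4) (by norm_num) (by norm_num) hq0 hq1
  exact h1.trans ((le_max_left _ _).trans h2)

/-- **Diagonal ceiling**: on `q = p` (schedule `T_L ≥ 1`) every certified lower bound `a` for ANY pair of space-time decoder families
satisfies `a ≤ 1/4`. [cite: RichardsonUrbanke2008, Lemma 4.78] [cite: DennisEtAl2002, §4.6 (p_c)] -/
theorem toric_dklp_threshold_diag_le_quarter {T : ℕ → ℕ} (hT : ∀ L, 0 < T L) (DZ : (L : ℕ) → STDecoder (L + 1) (T L))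
    (DX : ∀ L, CSSPhenom.STDecoder (Vertex (L + 1)) (Edge (L + 1)) (T L)) {a : ℝ}
    (ha : IsThresholdLowerBound (fun L p => (toricCode (L + 1)).bothSectorsPhenomFailureProb (T L) (DZ L) (DX L) p p) a) :
    a ≤ 1 / 4 := by
  by_contra h
  push Not at h
  have hlim := ha (1 / 4) (by norm_num) h
  have hge : ∀ L, (1 : ℝ) / 4 ≤ (toricCode (L + 1)).bothSectorsPhenomFailureProb (T L) (DZ L) (DX L) (1 / 4) (1 / 4) :=
    fun L => toric_dklp_quarter_le_failureProb (L + 1) (T L) (DZ L) (DX L) ⟨0, hT L⟩ (by norm_num) (by norm_num)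
  have := le_of_tendsto_of_tendsto' tendsto_const_nhds hlim hge
  norm_num at this

/-- **Certified diagonal interval `.0112 < p_c ≤ 1/4`** for the complete toric memory experiment (`q = p`; floor: every pair of
minimum-weight space-time decoders, poly `T_L ≥ 1`; ceiling: every pair of space-time decoders).
[cite: DennisEtAl2002, §5.3 eq. (threshold_iso_num) and §4.6] [cite: RichardsonUrbanke2008, Lemma 4.78] -/
theorem toric_dklp_accuracyThreshold_diag_mem {T : ℕ → ℕ} (hT : IsPolyBounded T) (hT1 : ∀ L, 0 < T L)
    (DZ : (L : ℕ) → STDecoder (L + 1) (T L))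
    (hDZ : ∀ L, (DZ L).IsMinWeight (stSyn (L + 1) (T L)) (stCycles (L + 1) (T L)) hammingNorm)
    (DX : ∀ L, CSSPhenom.STDecoder (Vertex (L + 1)) (Edge (L + 1)) (T L))
    (hDX : ∀ L, (DX L).IsMinWeight (CSSPhenom.stSyn (toricCode (L + 1)).HZ (T L))
      (CSSPhenom.stCycles (toricCode (L + 1)).HZ (T L)) hammingNorm) :
    (0.0112 : ℝ) < accuracyThreshold
        (fun L p => (toricCode (L + 1)).bothSectorsPhenomFailureProb (T L) (DZ L) (DX L) p p) ∧
      accuracyThreshold (fun L p => (toricCode (L + 1)).bothSectorsPhenomFailureProb (T L) (DZ L) (DX L) p p) ≤ 1 / 4 := by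
  refine ⟨?_, toric_dklp_threshold_diag_le_quarter hT1 DZ DX (isThresholdLowerBound_accuracyThreshold _)⟩
  have hbox := toric_dklp_isThresholdBoxLowerBound_kernelZ3SymmK12 hT DZ hDZ DX hDX
  exact lt_of_lt_of_le thresholdValue_47476_bounds.1
    (le_accuracyThreshold hbox.diagonal ((thresholdValue_le_half _).trans (by norm_num)))

/-- **Non-vacuity**: space-time MWPM decoders for both records exist (`T(L) = L + 1`), and the pair has the certified box `.0112`.
[cite: KorteVygen2002, §12.2 Thm 12.9] [cite: DennisEtAl2002, §5.1 p. 19] -/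
theorem exists_toric_dklp_mwpm_pair :
    ∃ (DZ : (L : ℕ) → STDecoder (L + 1) (L + 1))
      (DX : ∀ L, CSSPhenom.STDecoder (Vertex (L + 1)) (Edge (L + 1)) (L + 1)),
      (∀ L, IsMatchingDecoder (stMetric (L + 1) (L + 1)) (DZ L)) ∧
        (∀ L, IsMatchingDecoder (extMetric (CSSPhenom.stEnds (plaqEnds (L + 1)) (L + 1))) (DX L)) ∧
          IsThresholdBoxLowerBound
            (fun L p q => (toricCode (L + 1)).bothSectorsPhenomFailureProb (L + 1) (DZ L) (DX L) p q) 0.0112 := by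
  choose DZ hDZ using fun L => exists_isMatchingDecoder_st (L + 1) (L + 1)
  choose DX hDX using fun L => CSSPhenom.exists_isMatchingDecoder_stEnds (plaqEnds (L + 1)) (L + 1)
  exact ⟨DZ, DX, hDZ, hDX, toric_dklp_mwpm_isThresholdBoxLowerBound_0112 isPolyBounded_succ _ hDZ _ hDX⟩

end Summit.Ventures.QEC.Thresholds

end
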